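import Literature.NumberTheory.Automorphic.Liu2021.LemD1SplitPlaceHeckeEigenvaluesJunction
import Literature.NumberTheory.Automorphic.Liu2021.SplitPlaceHeckeEigenvalueReadings
import Literature.NumberTheory.Automorphic.UnitaryGroupSplitPlaceExceptionalSet
import HarnessLib

/-!
# [Liu2021, Lem. D.1 (2)+(4)] at the split places, rank 2 — the θ-GENERIC CHAIN FORM for the Def. 4.11 carriers, as a THEOREM

Topic `Literature/NumberTheory/Automorphic/Liu2021`; proof file (theorems only: no definition, no named fact, no instance, no `sorry`);
count-neutral.  Written for the d6 line of cell `hodgecm-mathlib` (card S4; A-plan2 (g11) 23:04:02Z (3) «S4 ASSEMBLER: conclude the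
θ-generic chain form»); HC_CM is NOT proved by anything here.

For a CM field `L`, ANY unitary splitting character `θ` (`θ.IsUnitary`, `IsSplittingChar L 1 θ`), a hermitian `J⋆ ∈ GL₂(L)` with a
rational frame `ᵗ(c g⋆)(t J⋆) g⋆ = diag dJ` (`dJ` real, non-zero), the line datum `(r, ε)` and the central character `χ` of
[Liu2021, Def. 4.11], let `ω⋆_θ := rhoVAtLine … (χ-splitting at θ) … (r ε) χ` be the Weil carrier of `U(diag dJ)(𝔸_{L⁺,f})` and
`ρ⋆ := ω⋆_θ ∘ (finAdelicCongr g⋆)⁻¹` its transport to `U(J⋆)`.  THEN (`lemD1_splitPlace_heckeEigenvalues_chain`) there is a finite set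
`S₀` of places of `L` such that at every `w ∉ S₀` split over `w⁺` with `J⋆_w ∈ GL₂(𝒪_w)`, for every level `K` hyperspecial at `w⁺`
and every `x ∈ ρ⋆^K`, the spherical operators `T_{w,1} = [K e_w⁻¹(diag(ϖ_w,1)) K]`, `T_{w,2}` act by
`T_{w,1} x = (√q_w · (θ_w(ϖ_w) + χ̌_w(ϖ_w) · θ_w(ϖ_w)⁻¹)) • x`, `T_{w,2} x = χ̌_w(ϖ_w) • x`
(`χ̌ = checkOfChi χ`, [Liu2021, App. D §D.1 l. 5224]; the scalars in the LITERAL spelling of the tree's local chain).  It is the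
composition BY NAME of ★ `Def411WeilCarriers.rhoVAtLine_congr_heckeTAt_apply_eq_smul` (S4c-G: the restricted-tensor model of `ω⋆_θ`
transported along the congruence, Flath + the split-place double-coset transport) at THE CM `θ`-package
(`borelPlaceMeasure`, `cmFinLocalFamily`), fed with the junction ★ `cm_hloc_one` / `cm_hloc_two` (`LemD1SplitPlaceHeckeEigenvaluesJunction`:
S4c-L's unramified principal-series eigenvalues at a split place, `ν = θ_w`, in S4c-G's `hloc` form), and ★
`exists_finite_splitPlace_conditions'` (one finite exceptional set for the survival set of the package, the good reduction of
`diag dJ` and of its doubling by the line, the integrality of `g⋆⁻¹` and the level matching of the local congruences).  The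
registered-carrier reading is also available PER PLACE in S4c-G's binders as ★
`Def411WeilCarriers.rhoVAtLine_congr_heckeTAt_apply_eq_galConj_labels` (`SplitPlaceHeckeEigenvaluesGlobalLabels`); this file is the
`∃ S₀`-packaged, `checkOfChi`-instantiated, hyperspecial-level form that the d6 socket `S4ShapeA` consumes by one application.

The two READINGS on algebraic Hecke characters for a conjugate-symplectic `μ` (★ `SplitPlaceHeckeEigenvalueReadings`):
* `lemD1_splitPlace_heckeEigenvalues_galConjCarrier` — the carrier at the `μᶜ`-splitting (the one of `thmD6OneCurveCUF`):
  `T_{w,1} x = ((μ^{alg})ᶜ(ϖ_w) + (μ^{alg}·χ̌)(ϖ_w)) • x`, `N(w) • T_{w,2} x = ((μ^{alg})ᶜ(ϖ_w) · (μ^{alg}·χ̌)(ϖ_w)) • x`;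
* `lemD1_splitPlace_heckeEigenvalues_muCarrier` — the carrier at the `μ`-splitting:
  `T_{w,1} x = (μ^{alg}(ϖ_w) + ((μ^{alg})ᶜ·χ̌)(ϖ_w)) • x`, `N(w) • T_{w,2} x = (μ^{alg}(ϖ_w) · ((μ^{alg})ᶜ·χ̌)(ϖ_w)) • x`.
Print ([Liu2021] proof of Lem. D.1, first paragraph, l. 5241): at a split place, through the first factor, `μ = ν ⊠ ν⁻¹` and
`ω(μ, ε, χ) ≅ Ind(ν∘det ⊠ χν^{1−n})` [GR90 (2.6)]; for `n = 2` the unramified vector of `Ind(χ₁ ⊠ χ₂)` has `T`-eigenvalue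
`q^{1/2}(χ₁ + χ₂)(ϖ)` and `S`-eigenvalue `χ₁χ₂(ϖ)` [CartierCorvallis1979 §IV (4.2)].

## References
* [Liu2021] Y. Liu, *Fourier–Jacobi cycles and arithmetic relative trace formula*, Camb. J. Math. 9 (2021) = arXiv:2102.11518: App. D §D.1
  Lemma D.1 (2), (4) (l. 5229–5235) and its proof, first paragraph (l. 5241, p. 126); Def. 4.11 (l. 2083–2097).
* [GelbartRogawski1991] S. Gelbart, J. Rogawski, Invent. Math. 105 (1991), §3.1 Prop. 3.1.1 p. 455, §3.2 p. 457.
* [CartierCorvallis1979] P. Cartier, *Representations of p-adic groups: a survey*, PSPM 33 part 1 (1979), §IV.1–IV.2 (4.2).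
* [PlatonovRapinchuk1994] V. Platonov, A. Rapinchuk, *Algebraic Groups and Number Theory* (1994), §5.1.
-/

set_option autoImplicit false

noncomputable section


open scoped Matrix Kronecker TensorProduct Classical RestrictedProduct MatrixGroups NumberField
open NumberField NumberField.InfinitePlace IsDedekindDomain Filter Set MulAction
open Literature.NumberTheory Literature.NumberTheory.Automorphic Literature.NumberTheory.Automorphic.UnitaryGroup
open Literature.NumberTheory.GelbartRogawski1991 Literature.NumberTheory.GelbartRogawski1991.UnitaryDualPair
open Literature.NumberTheory.GelbartRogawski1991.UnitaryDualPair.WeilCoinv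
open Literature.NumberTheory.GelbartRogawski1991.GRConstruction
open Literature.NumberTheory.Weil1964 Literature.RepresentationTheory
open Literature.RepresentationTheory.HeisenbergGroup
open Literature.NumberTheory.GaloisRepresentations Literature.RepresentationTheory.HarrisKudlaSweet1996
open Literature.NumberTheory.Automorphic.Liu2021.Def411WeilCarriersDoubling

namespace Literature.NumberTheory.Automorphic.Liu2021.Def411WeilCarriers

open Literature.NumberTheory.Automorphic.IdeleClassGroup Literature.RepresentationTheory.Liu2021
open Literature.NumberTheory.GelbartRogawski1991.UnitaryDualPair.LocalSplitting
/-! ## §1 The θ-generic chain form -/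

set_option maxHeartbeats 400000 in -- measured BY IMPORT 0.25 M: S4c-G inst. 50 k + ★ p750778 35 k + per-place 140 k + junction feeds ≈ 3 k + transports 10 k
/-- **[Liu2021, Lem. D.1 (2)+(4)] at the split places, rank 2 — the θ-GENERIC CHAIN FORM** (module docstring): for ANY unitary
splitting character `θ`, off ONE finite set of places of `L`, at every split `w` with `J⋆_w ∈ GL₂(𝒪_w)`, every hyperspecial `K`, every
`x ∈ (ω⋆_θ ∘ congr⁻¹)^K`: `T_{w,1} x = (√q_w·(θ_w(ϖ_w) + χ̌_w(ϖ_w)·θ_w(ϖ_w)⁻¹)) • x` and `T_{w,2} x = χ̌_w(ϖ_w) • x` (chain's literal spelling).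
[cite: Liu2021, App. D proof of Lemma D.1, first paragraph (l. 5241, p. 126); Lemma D.1 (2), (4) (l. 5229–5235)] [cite: GelbartRogawski1991, §3.2 p. 457] [cite: CartierCorvallis1979, §IV.2 (4.2)] [cite: PlatonovRapinchuk1994, §5.1] -/
theorem lemD1_splitPlace_heckeEigenvalues_chain (L : Type) [Field L] [NumberField L] [IsCMField L]
    (θ : HeckeCharacter L) (hθu : θ.IsUnitary) (hθs : IsSplittingChar L 1 θ)
    (Jstar : Matrix (Fin 2) (Fin 2) L) (t : L) (ht : t ≠ 0) (gstar : GL (Fin 2) L)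
    (dJ : Fin 2 → L) (hdJ : ∀ i, IsCMField.complexConj L (dJ i) = dJ i) (hdJ0 : ∀ i, dJ i ≠ 0)
    (hg : formCongr ((IsCMField.complexConj L) : L →+* L) gstar (t • Jstar) = Matrix.diagonal dJ)
    (r : Rep ↥(maximalRealSubfield L) (imagUnitSq L)) (ε : Eps ↥(maximalRealSubfield L) (imagUnitSq L)) (χ : Chi ↥(maximalRealSubfield L) L (IsCMField.complexConj L))
    (hJ : (Jstar.map (IsCMField.complexConj L))ᵀ = Jstar) (hJu : IsUnit Jstar) :
    ∃ S₀ : Set (HeightOneSpectrum (𝓞 L)), S₀.Finite ∧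
      ∀ w : HeightOneSpectrum (𝓞 L), w ∉ S₀ → ∀ hw : (IsCMField.complexConj L) • w ≠ w,
        (UnitaryGroup.isUnit_placeForm Jstar hJu w).unit ∈ glInt 2 (w.adicCompletion L) →
          ∀ K : Subgroup ↥(finAdelic ↥(maximalRealSubfield L) L (IsCMField.complexConj L) 2 Jstar),
            UnitaryGroup.IsHyperspecialAt ↥(maximalRealSubfield L) L (IsCMField.complexConj L) 2 Jstar K (w.under (𝓞 ↥(maximalRealSubfield L))) →
            ∀ x ∈ Representation.fixedPoints
                ((rhoVAtLine ↥(maximalRealSubfield L) L (IsCMField.complexConj L) 2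
                  (finProdFinEquiv : Fin 2 × Fin 1 ≃ Fin (2 * 1)) (Matrix.diagonal dJ)
                  (complexConj_imagUnit L) (imagUnit_ne_zero L) (imagUnit_mul_self L) (realDiagonal_isSymm L dJ hdJ)
                  (isUnit_det_realDiagonal L dJ hdJ hdJ0) (realDiagonal_map L dJ hdJ).symm
                  (fun a => isCompatible_chiSplittingLine L finProdFinEquiv dJ hdJ hdJ0 θ hθu hθs
                    (TW ↥(maximalRealSubfield L) a) (isSymm_TW ↥(maximalRealSubfield L) a) (isUnit_det_TW ↥(maximalRealSubfield L) a) (JW ↥(maximalRealSubfield L) L a) (JW_eq ↥(maximalRealSubfield L) L a))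
                  (r.toFun ε) χ).comp
                  (finAdelicCongr ↥(maximalRealSubfield L) L (IsCMField.complexConj L) gstar ht hg).symm.toMonoidHom) K,
              UnitaryGroup.heckeTAt ↥(maximalRealSubfield L) L (IsCMField.complexConj L) 2 Jstar
                ((rhoVAtLine ↥(maximalRealSubfield L) L (IsCMField.complexConj L) 2
                  (finProdFinEquiv : Fin 2 × Fin 1 ≃ Fin (2 * 1)) (Matrix.diagonal dJ)
                  (complexConj_imagUnit L) (imagUnit_ne_zero L) (imagUnit_mul_self L) (realDiagonal_isSymm L dJ hdJ)
                  (isUnit_det_realDiagonal L dJ hdJ hdJ0) (realDiagonal_map L dJ hdJ).symm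
                  (fun a => isCompatible_chiSplittingLine L finProdFinEquiv dJ hdJ hdJ0 θ hθu hθs
                    (TW ↥(maximalRealSubfield L) a) (isSymm_TW ↥(maximalRealSubfield L) a) (isUnit_det_TW ↥(maximalRealSubfield L) a) (JW ↥(maximalRealSubfield L) L a) (JW_eq ↥(maximalRealSubfield L) L a))
                  (r.toFun ε) χ).comp
                  (finAdelicCongr ↥(maximalRealSubfield L) L (IsCMField.complexConj L) gstar ht hg).symm.toMonoidHom)
                K (⟨w, rfl⟩ : UnitaryGroup.PlacesOver L (w.under (𝓞 ↥(maximalRealSubfield L))))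
                (IsCMField.complexConj_ne_one L) hJ hw (UnitaryGroup.isUnit_placeForm Jstar hJu w) (HeckeCharacter.uniformizer L w) 1 x =
                (((Real.sqrt (GaloisRepresentations.IsNonarchimedeanLocalField.residueFieldCard (w.adicCompletion L))) : ℂ) *
                  ((((θ.localComponent w) (Units.mk0 ((HeckeCharacter.uniformizer L w : (w.adicCompletion L)ˣ) : w.adicCompletion L)
                      (Units.ne_zero _)) : ℂˣ) : ℂ) +
                    ((((HeckeCharacter.checkOfChi (complexConj_mul_complexConj' L) χ).localComponent w)
                        (Units.mk0 ((HeckeCharacter.uniformizer L w : (w.adicCompletion L)ˣ) : w.adicCompletion L) (Units.ne_zero _)) : ℂˣ) : ℂ) *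
                      ((((θ.localComponent w) (Units.mk0 ((HeckeCharacter.uniformizer L w : (w.adicCompletion L)ˣ) : w.adicCompletion L)
                        (Units.ne_zero _)) : ℂˣ) : ℂ))⁻¹)) • x ∧
              UnitaryGroup.heckeTAt ↥(maximalRealSubfield L) L (IsCMField.complexConj L) 2 Jstar
                ((rhoVAtLine ↥(maximalRealSubfield L) L (IsCMField.complexConj L) 2
                  (finProdFinEquiv : Fin 2 × Fin 1 ≃ Fin (2 * 1)) (Matrix.diagonal dJ)
                  (complexConj_imagUnit L) (imagUnit_ne_zero L) (imagUnit_mul_self L) (realDiagonal_isSymm L dJ hdJ)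
                  (isUnit_det_realDiagonal L dJ hdJ hdJ0) (realDiagonal_map L dJ hdJ).symm
                  (fun a => isCompatible_chiSplittingLine L finProdFinEquiv dJ hdJ hdJ0 θ hθu hθs
                    (TW ↥(maximalRealSubfield L) a) (isSymm_TW ↥(maximalRealSubfield L) a) (isUnit_det_TW ↥(maximalRealSubfield L) a) (JW ↥(maximalRealSubfield L) L a) (JW_eq ↥(maximalRealSubfield L) L a))
                  (r.toFun ε) χ).comp
                  (finAdelicCongr ↥(maximalRealSubfield L) L (IsCMField.complexConj L) gstar ht hg).symm.toMonoidHom)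
                K (⟨w, rfl⟩ : UnitaryGroup.PlacesOver L (w.under (𝓞 ↥(maximalRealSubfield L))))
                (IsCMField.complexConj_ne_one L) hJ hw (UnitaryGroup.isUnit_placeForm Jstar hJu w) (HeckeCharacter.uniformizer L w) 2 x =
                ((((HeckeCharacter.checkOfChi (complexConj_mul_complexConj' L) χ).localComponent w)
                    (Units.mk0 ((HeckeCharacter.uniformizer L w : (w.adicCompletion L)ˣ) : w.adicCompletion L) (Units.ne_zero _)) : ℂˣ) : ℂ) • x := by
  have hc1 : IsCMField.complexConj L ≠ 1 := IsCMField.complexConj_ne_one L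
  have hJd : ((Matrix.diagonal dJ).map (IsCMField.complexConj L))ᵀ = Matrix.diagonal dJ := conjTranspose_realDiagonal L dJ hdJ
  have hJdu : IsUnit (Matrix.diagonal dJ) := isUnit_realDiagonal L dJ hdJ0
  have hJDh := conjTranspose_diagonalKroneckerLine L dJ hdJ (r.toFun ε)
  have hJDu := isUnit_diagonalKroneckerLine L dJ hdJ hdJ0 (r.toFun ε)
  -- S4c-G (A-p05): the survival set `S₁` and the transport of local eigen-equations, at THE CM package of `θ`
  obtain ⟨S₁, hG⟩ := rhoVAtLine_congr_heckeTAt_apply_eq_smul L (finProdFinEquiv : Fin 2 × Fin 1 ≃ Fin (2 * 1)) dJ hdJ hdJ0 θ hθu hθs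
    (r.toFun ε) χ (borelPlaceMeasure L)
    (cmFinLocalFamily L finProdFinEquiv dJ hdJ hdJ0 (lineW L (TW ↥(maximalRealSubfield L) (r.toFun ε)))
      (complexConj_lineW L (TW ↥(maximalRealSubfield L) (r.toFun ε)))
      (lineW_ne_zero L (TW ↥(maximalRealSubfield L) (r.toFun ε)) (isUnit_det_TW ↥(maximalRealSubfield L) (r.toFun ε))) θ hθs
      (borelPlaceMeasure L))
    Jstar t ht gstar hg hJ hJd
  -- ONE finite exceptional set of places of `L` (A-p02 (g13) ★ p750778 `exists_finite_splitPlace_conditions'`): `w⁺ ∉ S₁`,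
  -- good reduction of `diag dJ` and of its doubling by the line, integrality of `g⋆⁻¹`, level-matching of the local congruence
  obtain ⟨S₀, hS₀f, hS₀⟩ := exists_finite_splitPlace_conditions' L (IsCMField.complexConj L) hJdu _ hJDu gstar⁻¹ (inv_ne_zero ht)
    (formCongr_inv_smul_of_formCongr gstar ht hg) S₁
  refine ⟨S₀, hS₀f, fun w hwS hw hJwi K hK x hx => ?_⟩
  obtain ⟨hv1, hw4, hw5, hv2, hv3⟩ := hS₀ w hwS
  have hϖ := isUniformizingElement_heckeCharacterUniformizer L w
  -- S4c-G at THIS place (anchor spelt `w.under (𝓞 (Fp L))` = S4c-G's own, so the junction lemmas feed it SYNTACTICALLY), `ϖ := mk0 ↑ϖ_w`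
  have hGw := hG (w.under (𝓞 (Fp L))) hv1 ⟨w, rfl⟩ hw (isUnit_placeForm Jstar hJu w)
    (isUnit_placeForm (Matrix.diagonal dJ) hJdu w) hw4 hv2 hv3 K hK
    (Units.mk0 ((HeckeCharacter.uniformizer L w : (w.adicCompletion L)ˣ) : w.adicCompletion L) hϖ.ne_zero)
  have e : Units.mk0 ((HeckeCharacter.uniformizer L w : (w.adicCompletion L)ˣ) : w.adicCompletion L) hϖ.ne_zero =
      HeckeCharacter.uniformizer L w := Units.mk0_val _ _
  -- the junction (S4c-L at the CM package) at `i = 1, 2`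
  have J1 := cm_hloc_one L θ hθu hθs dJ hdJ hdJ0 r ε χ ⟨w, rfl⟩ hw hw5
  have T1a := hGw 1 _ J1
  have T1 := T1a x hx
  have J2 := cm_hloc_two L θ hθu hθs dJ hdJ hdJ0 r ε χ ⟨w, rfl⟩ hw hw5
  have T2a := hGw 2 _ J2
  have T2 := T2a x hx
  exact ⟨heckeTAt_apply_eq_of_eq e T1, heckeTAt_apply_eq_of_eq e T2⟩

/-! ## §2 The two readings on algebraic Hecke characters -/

/-- **Reading (A): the carrier at the `μᶜ`-splitting** (the `ω⋆` of `thmD6OneCurveCUF`, A-p15's `S4ShapeA`): for `μ`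
conjugate-symplectic, off a finite set, at every split `w` with `J⋆_w ∈ GL₂(𝒪_w)`, every hyperspecial `K`, every fixed `x`:
`T_{w,1} x = ((μ^{alg})ᶜ(ϖ_w) + (μ^{alg}·χ̌)(ϖ_w)) • x` and `N(w) • T_{w,2} x = ((μ^{alg})ᶜ(ϖ_w)·(μ^{alg}·χ̌)(ϖ_w)) • x`
(`lemD1_splitPlace_heckeEigenvalues_chain` + ★ `eigen_eq_galConj_labels_of_chain`).
[cite: Liu2021, App. D proof of Lemma D.1, first paragraph (l. 5241, p. 126); Lemma D.1 (2), (4) (l. 5229–5235)] [cite: GelbartRogawski1991, §3.2 p. 457] [cite: CartierCorvallis1979, §IV.2 (4.2)] -/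
theorem lemD1_splitPlace_heckeEigenvalues_galConjCarrier (L : Type) [Field L] [NumberField L] [IsCMField L]
    (μ : Literature.NumberTheory.Automorphic.IdeleClassGroup L →ₜ* Circle)
    (hμ : IdeleClassGroup.IsConjugateSymplectic L μ)
    (Jstar : Matrix (Fin 2) (Fin 2) L) (t : L) (ht : t ≠ 0) (gstar : GL (Fin 2) L)
    (dJ : Fin 2 → L) (hdJ : ∀ i, IsCMField.complexConj L (dJ i) = dJ i) (hdJ0 : ∀ i, dJ i ≠ 0)
    (hg : formCongr ((IsCMField.complexConj L) : L →+* L) gstar (t • Jstar) = Matrix.diagonal dJ)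
    (r : Rep ↥(maximalRealSubfield L) (imagUnitSq L)) (ε : Eps ↥(maximalRealSubfield L) (imagUnitSq L)) (χ : Chi ↥(maximalRealSubfield L) L (IsCMField.complexConj L))
    (hJ : (Jstar.map (IsCMField.complexConj L))ᵀ = Jstar) (hJu : IsUnit Jstar) :
    ∃ S₀ : Set (HeightOneSpectrum (𝓞 L)), S₀.Finite ∧
      ∀ w : HeightOneSpectrum (𝓞 L), w ∉ S₀ → ∀ hw : (IsCMField.complexConj L) • w ≠ w,
        (UnitaryGroup.isUnit_placeForm Jstar hJu w).unit ∈ glInt 2 (w.adicCompletion L) →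
          ∀ K : Subgroup ↥(finAdelic ↥(maximalRealSubfield L) L (IsCMField.complexConj L) 2 Jstar),
            UnitaryGroup.IsHyperspecialAt ↥(maximalRealSubfield L) L (IsCMField.complexConj L) 2 Jstar K (w.under (𝓞 ↥(maximalRealSubfield L))) →
            ∀ x ∈ Representation.fixedPoints
                ((rhoVAtLine ↥(maximalRealSubfield L) L (IsCMField.complexConj L) 2
                  (finProdFinEquiv : Fin 2 × Fin 1 ≃ Fin (2 * 1)) (Matrix.diagonal dJ)
                  (complexConj_imagUnit L) (imagUnit_ne_zero L) (imagUnit_mul_self L) (realDiagonal_isSymm L dJ hdJ)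
                  (isUnit_det_realDiagonal L dJ hdJ hdJ0) (realDiagonal_map L dJ hdJ).symm
                  (fun a => isCompatible_chiSplittingLine L finProdFinEquiv dJ hdJ hdJ0
                    (toHeckeCharacter L (galConj (IsCMField.complexConj L) μ))
                    (isUnitary_toHeckeCharacter L (galConj (IsCMField.complexConj L) μ))
                    ((isOscillatorChar_toHeckeCharacter_iff (galConj (IsCMField.complexConj L) μ)).mpr hμ.galConj)
                    (TW ↥(maximalRealSubfield L) a) (isSymm_TW ↥(maximalRealSubfield L) a) (isUnit_det_TW ↥(maximalRealSubfield L) a) (JW ↥(maximalRealSubfield L) L a) (JW_eq ↥(maximalRealSubfield L) L a))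
                  (r.toFun ε) χ).comp
                  (finAdelicCongr ↥(maximalRealSubfield L) L (IsCMField.complexConj L) gstar ht hg).symm.toMonoidHom) K,
              UnitaryGroup.heckeTAt ↥(maximalRealSubfield L) L (IsCMField.complexConj L) 2 Jstar
                ((rhoVAtLine ↥(maximalRealSubfield L) L (IsCMField.complexConj L) 2
                  (finProdFinEquiv : Fin 2 × Fin 1 ≃ Fin (2 * 1)) (Matrix.diagonal dJ)
                  (complexConj_imagUnit L) (imagUnit_ne_zero L) (imagUnit_mul_self L) (realDiagonal_isSymm L dJ hdJ)
                  (isUnit_det_realDiagonal L dJ hdJ hdJ0) (realDiagonal_map L dJ hdJ).symm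
                  (fun a => isCompatible_chiSplittingLine L finProdFinEquiv dJ hdJ hdJ0
                    (toHeckeCharacter L (galConj (IsCMField.complexConj L) μ))
                    (isUnitary_toHeckeCharacter L (galConj (IsCMField.complexConj L) μ))
                    ((isOscillatorChar_toHeckeCharacter_iff (galConj (IsCMField.complexConj L) μ)).mpr hμ.galConj)
                    (TW ↥(maximalRealSubfield L) a) (isSymm_TW ↥(maximalRealSubfield L) a) (isUnit_det_TW ↥(maximalRealSubfield L) a) (JW ↥(maximalRealSubfield L) L a) (JW_eq ↥(maximalRealSubfield L) L a))
                  (r.toFun ε) χ).comp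
                  (finAdelicCongr ↥(maximalRealSubfield L) L (IsCMField.complexConj L) gstar ht hg).symm.toMonoidHom)
                K (⟨w, rfl⟩ : UnitaryGroup.PlacesOver L (w.under (𝓞 ↥(maximalRealSubfield L))))
                (IsCMField.complexConj_ne_one L) hJ hw (UnitaryGroup.isUnit_placeForm Jstar hJu w) (HeckeCharacter.uniformizer L w) 1 x =
                ((HeckeCharacter.galConj (IsCMField.complexConj L) (IdeleClassGroup.muAlg L μ)).valueAtUniformizer w +
                  (IdeleClassGroup.muAlg L μ *
                  HeckeCharacter.checkOfChi (complexConj_mul_complexConj' L) χ).valueAtUniformizer w) • x ∧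
              (Ideal.absNorm w.asIdeal : ℂ) •
              UnitaryGroup.heckeTAt ↥(maximalRealSubfield L) L (IsCMField.complexConj L) 2 Jstar
                ((rhoVAtLine ↥(maximalRealSubfield L) L (IsCMField.complexConj L) 2
                  (finProdFinEquiv : Fin 2 × Fin 1 ≃ Fin (2 * 1)) (Matrix.diagonal dJ)
                  (complexConj_imagUnit L) (imagUnit_ne_zero L) (imagUnit_mul_self L) (realDiagonal_isSymm L dJ hdJ)
                  (isUnit_det_realDiagonal L dJ hdJ hdJ0) (realDiagonal_map L dJ hdJ).symm
                  (fun a => isCompatible_chiSplittingLine L finProdFinEquiv dJ hdJ hdJ0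
                    (toHeckeCharacter L (galConj (IsCMField.complexConj L) μ))
                    (isUnitary_toHeckeCharacter L (galConj (IsCMField.complexConj L) μ))
                    ((isOscillatorChar_toHeckeCharacter_iff (galConj (IsCMField.complexConj L) μ)).mpr hμ.galConj)
                    (TW ↥(maximalRealSubfield L) a) (isSymm_TW ↥(maximalRealSubfield L) a) (isUnit_det_TW ↥(maximalRealSubfield L) a) (JW ↥(maximalRealSubfield L) L a) (JW_eq ↥(maximalRealSubfield L) L a))
                  (r.toFun ε) χ).comp
                  (finAdelicCongr ↥(maximalRealSubfield L) L (IsCMField.complexConj L) gstar ht hg).symm.toMonoidHom)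
                K (⟨w, rfl⟩ : UnitaryGroup.PlacesOver L (w.under (𝓞 ↥(maximalRealSubfield L))))
                (IsCMField.complexConj_ne_one L) hJ hw (UnitaryGroup.isUnit_placeForm Jstar hJu w) (HeckeCharacter.uniformizer L w) 2 x =
                ((HeckeCharacter.galConj (IsCMField.complexConj L) (IdeleClassGroup.muAlg L μ)).valueAtUniformizer w *
                  (IdeleClassGroup.muAlg L μ *
                  HeckeCharacter.checkOfChi (complexConj_mul_complexConj' L) χ).valueAtUniformizer w) • x
 := by
  obtain ⟨S₀, hS₀f, h⟩ := lemD1_splitPlace_heckeEigenvalues_chain L (toHeckeCharacter L (galConj (IsCMField.complexConj L) μ))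
    (isUnitary_toHeckeCharacter L (galConj (IsCMField.complexConj L) μ))
    ((isOscillatorChar_toHeckeCharacter_iff (galConj (IsCMField.complexConj L) μ)).mpr hμ.galConj)
    Jstar t ht gstar dJ hdJ hdJ0 hg r ε χ hJ hJu
  refine ⟨S₀, hS₀f, fun w hwS hw hJwi K hK x hx => ?_⟩
  obtain ⟨h₁, h₂⟩ := h w hwS hw hJwi K hK x hx
  exact eigen_eq_galConj_labels_of_chain hμ.isConjugateSelfDual _ w (Units.ne_zero _) h₁ h₂

/-- **Reading (B): the carrier at the `μ`-splitting**: for `μ` conjugate-symplectic, off a finite set, at every split `w` with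
`J⋆_w ∈ GL₂(𝒪_w)`, every hyperspecial `K`, every fixed `x`:
`T_{w,1} x = (μ^{alg}(ϖ_w) + ((μ^{alg})ᶜ·χ̌)(ϖ_w)) • x` and `N(w) • T_{w,2} x = (μ^{alg}(ϖ_w)·((μ^{alg})ᶜ·χ̌)(ϖ_w)) • x`
(`lemD1_splitPlace_heckeEigenvalues_chain` + ★ `eigen_eq_labels_of_chain`).
[cite: Liu2021, App. D proof of Lemma D.1, first paragraph (l. 5241, p. 126); Lemma D.1 (2), (4) (l. 5229–5235)] [cite: GelbartRogawski1991, §3.2 p. 457] [cite: CartierCorvallis1979, §IV.2 (4.2)] -/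
theorem lemD1_splitPlace_heckeEigenvalues_muCarrier (L : Type) [Field L] [NumberField L] [IsCMField L]
    (μ : Literature.NumberTheory.Automorphic.IdeleClassGroup L →ₜ* Circle)
    (hμ : IdeleClassGroup.IsConjugateSymplectic L μ)
    (Jstar : Matrix (Fin 2) (Fin 2) L) (t : L) (ht : t ≠ 0) (gstar : GL (Fin 2) L)
    (dJ : Fin 2 → L) (hdJ : ∀ i, IsCMField.complexConj L (dJ i) = dJ i) (hdJ0 : ∀ i, dJ i ≠ 0)
    (hg : formCongr ((IsCMField.complexConj L) : L →+* L) gstar (t • Jstar) = Matrix.diagonal dJ)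
    (r : Rep ↥(maximalRealSubfield L) (imagUnitSq L)) (ε : Eps ↥(maximalRealSubfield L) (imagUnitSq L)) (χ : Chi ↥(maximalRealSubfield L) L (IsCMField.complexConj L))
    (hJ : (Jstar.map (IsCMField.complexConj L))ᵀ = Jstar) (hJu : IsUnit Jstar) :
    ∃ S₀ : Set (HeightOneSpectrum (𝓞 L)), S₀.Finite ∧
      ∀ w : HeightOneSpectrum (𝓞 L), w ∉ S₀ → ∀ hw : (IsCMField.complexConj L) • w ≠ w,
        (UnitaryGroup.isUnit_placeForm Jstar hJu w).unit ∈ glInt 2 (w.adicCompletion L) →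
          ∀ K : Subgroup ↥(finAdelic ↥(maximalRealSubfield L) L (IsCMField.complexConj L) 2 Jstar),
            UnitaryGroup.IsHyperspecialAt ↥(maximalRealSubfield L) L (IsCMField.complexConj L) 2 Jstar K (w.under (𝓞 ↥(maximalRealSubfield L))) →
            ∀ x ∈ Representation.fixedPoints
                ((rhoVAtLine ↥(maximalRealSubfield L) L (IsCMField.complexConj L) 2
                  (finProdFinEquiv : Fin 2 × Fin 1 ≃ Fin (2 * 1)) (Matrix.diagonal dJ)
                  (complexConj_imagUnit L) (imagUnit_ne_zero L) (imagUnit_mul_self L) (realDiagonal_isSymm L dJ hdJ)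
                  (isUnit_det_realDiagonal L dJ hdJ hdJ0) (realDiagonal_map L dJ hdJ).symm
                  (fun a => isCompatible_chiSplittingLine L finProdFinEquiv dJ hdJ hdJ0
                    (toHeckeCharacter L μ)
                    (isUnitary_toHeckeCharacter L μ)
                    ((isOscillatorChar_toHeckeCharacter_iff μ).mpr hμ)
                    (TW ↥(maximalRealSubfield L) a) (isSymm_TW ↥(maximalRealSubfield L) a) (isUnit_det_TW ↥(maximalRealSubfield L) a) (JW ↥(maximalRealSubfield L) L a) (JW_eq ↥(maximalRealSubfield L) L a))
                  (r.toFun ε) χ).comp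
                  (finAdelicCongr ↥(maximalRealSubfield L) L (IsCMField.complexConj L) gstar ht hg).symm.toMonoidHom) K,
              UnitaryGroup.heckeTAt ↥(maximalRealSubfield L) L (IsCMField.complexConj L) 2 Jstar
                ((rhoVAtLine ↥(maximalRealSubfield L) L (IsCMField.complexConj L) 2
                  (finProdFinEquiv : Fin 2 × Fin 1 ≃ Fin (2 * 1)) (Matrix.diagonal dJ)
                  (complexConj_imagUnit L) (imagUnit_ne_zero L) (imagUnit_mul_self L) (realDiagonal_isSymm L dJ hdJ)
                  (isUnit_det_realDiagonal L dJ hdJ hdJ0) (realDiagonal_map L dJ hdJ).symm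
                  (fun a => isCompatible_chiSplittingLine L finProdFinEquiv dJ hdJ hdJ0
                    (toHeckeCharacter L μ)
                    (isUnitary_toHeckeCharacter L μ)
                    ((isOscillatorChar_toHeckeCharacter_iff μ).mpr hμ)
                    (TW ↥(maximalRealSubfield L) a) (isSymm_TW ↥(maximalRealSubfield L) a) (isUnit_det_TW ↥(maximalRealSubfield L) a) (JW ↥(maximalRealSubfield L) L a) (JW_eq ↥(maximalRealSubfield L) L a))
                  (r.toFun ε) χ).comp
                  (finAdelicCongr ↥(maximalRealSubfield L) L (IsCMField.complexConj L) gstar ht hg).symm.toMonoidHom)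
                K (⟨w, rfl⟩ : UnitaryGroup.PlacesOver L (w.under (𝓞 ↥(maximalRealSubfield L))))
                (IsCMField.complexConj_ne_one L) hJ hw (UnitaryGroup.isUnit_placeForm Jstar hJu w) (HeckeCharacter.uniformizer L w) 1 x =
                ((IdeleClassGroup.muAlg L μ).valueAtUniformizer w +
                  (HeckeCharacter.galConj (IsCMField.complexConj L) (IdeleClassGroup.muAlg L μ) *
                  HeckeCharacter.checkOfChi (complexConj_mul_complexConj' L) χ).valueAtUniformizer w) • x ∧
              (Ideal.absNorm w.asIdeal : ℂ) •
              UnitaryGroup.heckeTAt ↥(maximalRealSubfield L) L (IsCMField.complexConj L) 2 Jstar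
                ((rhoVAtLine ↥(maximalRealSubfield L) L (IsCMField.complexConj L) 2
                  (finProdFinEquiv : Fin 2 × Fin 1 ≃ Fin (2 * 1)) (Matrix.diagonal dJ)
                  (complexConj_imagUnit L) (imagUnit_ne_zero L) (imagUnit_mul_self L) (realDiagonal_isSymm L dJ hdJ)
                  (isUnit_det_realDiagonal L dJ hdJ hdJ0) (realDiagonal_map L dJ hdJ).symm
                  (fun a => isCompatible_chiSplittingLine L finProdFinEquiv dJ hdJ hdJ0
                    (toHeckeCharacter L μ)
                    (isUnitary_toHeckeCharacter L μ)
                    ((isOscillatorChar_toHeckeCharacter_iff μ).mpr hμ)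
                    (TW ↥(maximalRealSubfield L) a) (isSymm_TW ↥(maximalRealSubfield L) a) (isUnit_det_TW ↥(maximalRealSubfield L) a) (JW ↥(maximalRealSubfield L) L a) (JW_eq ↥(maximalRealSubfield L) L a))
                  (r.toFun ε) χ).comp
                  (finAdelicCongr ↥(maximalRealSubfield L) L (IsCMField.complexConj L) gstar ht hg).symm.toMonoidHom)
                K (⟨w, rfl⟩ : UnitaryGroup.PlacesOver L (w.under (𝓞 ↥(maximalRealSubfield L))))
                (IsCMField.complexConj_ne_one L) hJ hw (UnitaryGroup.isUnit_placeForm Jstar hJu w) (HeckeCharacter.uniformizer L w) 2 x =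
                ((IdeleClassGroup.muAlg L μ).valueAtUniformizer w *
                  (HeckeCharacter.galConj (IsCMField.complexConj L) (IdeleClassGroup.muAlg L μ) *
                  HeckeCharacter.checkOfChi (complexConj_mul_complexConj' L) χ).valueAtUniformizer w) • x
 := by
  obtain ⟨S₀, hS₀f, h⟩ := lemD1_splitPlace_heckeEigenvalues_chain L (toHeckeCharacter L μ) (isUnitary_toHeckeCharacter L μ)
    ((isOscillatorChar_toHeckeCharacter_iff μ).mpr hμ) Jstar t ht gstar dJ hdJ hdJ0 hg r ε χ hJ hJu
  refine ⟨S₀, hS₀f, fun w hwS hw hJwi K hK x hx => ?_⟩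
  obtain ⟨h₁, h₂⟩ := h w hwS hw hJwi K hK x hx
  exact eigen_eq_labels_of_chain hμ.isConjugateSelfDual _ w (Units.ne_zero _) h₁ h₂

end Literature.NumberTheory.Automorphic.Liu2021.Def411WeilCarriers

end
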